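import Mathlib
import HarnessLib
import Literature.Analysis.FluidPDE.GigaMiura2011DirectionGradientHolds
import Summits.NavierStokesRegularity.NavierStokesRegularity.Theorems.PoloidalWindowDoorPoloidalWindowRigidityZShockSlopeFunctionParallel
import Summits.NavierStokesRegularity.NavierStokesRegularity.Theorems.PoloidalWindowDoorPoloidalWindowRigidityConstantShearMeans
import Summits.NavierStokesRegularity.NavierStokesRegularity.Theorems.PoloidalWindowDoorPoloidalWindowRigidityHorizontalSourceGauge

/-!
# Crux K2 `PoloidalWindowRigidity` (stmt-NavierStokesRegularity-19708), line `z_shock` — LEMMA L0(a): GLOBALISATION OF THE LOCAL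
# AUTONOMY CLAUSE of the deciding stub `stub_zShockThickAut` along the analytic slice

`--supports stmt-NavierStokesRegularity-19708 --as helper` (leafhand-ns-poloidalwindowdoor-1 g0, 2026-08-30).
**No stub and no summit is closed by this file; Navier–Stokes regularity is NOT proved here.**

The deciding stub `stub_zShockThickAut` of the registered skeleton `Cruxes/PoloidalWindowRigidity/Lines/z_shock.lean` (sha16
c3e8eee2) carries the LOCAL autonomy clause
`∃ g W₁, … z₀ ∈ W₁ ∧ ∀ z ∈ W₁, ∀ b ≠ 2, ∂_z v_b = g(t, v₂)·∂_b v₂`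
(slope `Λ_b = ∂_z v_b / ∂_b v₂` a function of `(t, w)`, `w = v₂`, near ONE window point, NO regularity on `g`), while the
Lax–John / Alinhac mechanism of the line runs along the whole height axis of the slice.  The card's FIRST LEMMA L0(a)
(`Lines/z_shock.md` §«First lemma of R3», price P1′ of idea-crit-7: «local Aut + slice analyticity ⇒ `D_b ≡ 0` on `{t₀} × ℝ³`»,
`D_b := (∂_b w·∇(∂_z v_b) − ∂_z v_b·∇(∂_b w)) × ∇w`) is proved here:

* `minors_eq_zero_of_local_slope_function` (class-free): for a real-analytic `f : ℝ³ → ℝ³` and `b : Fin 3`, if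
  `∂_z f_b = g(f₂)·∂_b f₂` on a nonempty open set `U` for SOME `g : ℝ → ℝ`, then at EVERY `x ∈ ℝ³` all `2 × 2` minors of the pair
  `(∂_b f₂·D(∂_z f_b) − ∂_z f_b·D(∂_b f₂), D f₂)(x)` vanish (`D_b(x) × ∇f₂(x) = 0`).  Proof: where `∂_b f₂ ≠ 0` on `U` the pointwise
  functional-dependence lemma `…ZShockSlopeFunctionParallel.exists_sub_smul_eq_smul_of_eventuallyEq_mul` (direction `e_b`) gives the
  minors; they are real-analytic functions of `x` (`AnalyticOnNhd.fderiv`, continuous linear evaluations), so the identity theorem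
  (`AnalyticOnNhd.eqOn_zero_of_preconnected_of_eventuallyEq_zero`, `ℝ³` preconnected) globalises; if `∂_b f₂ ≡ 0` on `U` then
  `∂_b f₂ ≡ 0` on `ℝ³` by the same theorem and `D_b ≡ 0` trivially.
* `minors_eq_zero_of_class_autonomy` (class entry): for a profile of the route's Type-I ancient mild class (Type-I rate, continuity,
  the Oseen identity), every slice `v(t₀,·)`, `t₀ < 0`, is real-analytic (tree
  `Literature…LocalSineTubeDoorProfileAlignedWindowRigidityAncient.analyticOnNhd_slice`), so the stub's local clause at a window point
  `z₀` forces `D_b(x) × ∇v₂(t₀,x) = 0` for `b ≠ 2` and ALL `x ∈ ℝ³`, `t₀ = z₀.1`.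

What L0(a) does NOT do (card, L0(b)/(c)): it does not produce a slice-global slope FUNCTION `g̃(t,w)` (multi-valuedness across
different components of a level set `{w = c}` remains), and it says nothing about R3.  presearch: see the companion file
`…ZShockSlopeFunctionParallel` (functional dependence / rank-one Jacobian: nothing in Mathlib or the tree). [folklore]
-/

noncomputable section

namespace Summit.NavierStokesRegularity.NavierStokesRegularity.Theorems.PoloidalWindowDoorPoloidalWindowRigidityZShockAutonomyGlobal

-- the problem directory repeats the summit name (`NavierStokesRegularity/NavierStokesRegularity`)
set_option linter.dupNamespace false

open Set Filter Topology Function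
open Summit.NavierStokesRegularity.NavierStokesRegularity.Theorems.PoloidalWindowDoorPoloidalWindowRigidityZShockSlopeFunctionParallel
open Summit.NavierStokesRegularity.NavierStokesRegularity.Theorems.PoloidalWindowDoorPoloidalWindowRigidityConstantShearMeans
  (fderiv_coord_apply)
open Summit.NavierStokesRegularity.NavierStokesRegularity.Theorems.PoloidalWindowDoorPoloidalWindowRigidityHorizontalSourceGauge
  (analyticOnNhd_fderiv_apply_coord)

/-! ## Analytic plumbing on `ℝ³` (coordinate / first-derivative-entry lemmas reused from `…ConstantShearMeans.fderiv_coord_apply` and `…HorizontalSourceGauge.analyticOnNhd_fderiv_apply_coord`) -/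

/-- A component of a real-analytic field is real-analytic. [folklore] -/
theorem analyticOnNhd_coord {f : EuclideanSpace ℝ (Fin 3) → EuclideanSpace ℝ (Fin 3)}
    (hf : AnalyticOnNhd ℝ f univ) (i : Fin 3) : AnalyticOnNhd ℝ (fun y => f y i) univ := by
  rw [show (fun y => f y i) = (EuclideanSpace.proj (𝕜 := ℝ) i) ∘ f from rfl]
  exact (EuclideanSpace.proj (𝕜 := ℝ) i).comp_analyticOnNhd hf

/-- Directional derivatives `x ↦ Dφ(x) u` of a real-analytic scalar function are real-analytic. [folklore] -/
theorem analyticOnNhd_fderiv_apply {φ : EuclideanSpace ℝ (Fin 3) → ℝ} (hφ : AnalyticOnNhd ℝ φ univ)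
    (u : EuclideanSpace ℝ (Fin 3)) : AnalyticOnNhd ℝ (fun y => fderiv ℝ φ y u) univ := by
  have h := (ContinuousLinearMap.apply ℝ ℝ u).comp_analyticOnNhd hφ.fderiv
  refine (h.congr isOpen_univ fun y _ => ?_)
  simp only [Function.comp_apply, ContinuousLinearMap.apply_apply]

/-! ## L0(a), class-free form -/

/-- **L0(a), class-free: a LOCAL slope function forces `D_b × ∇f₂ = 0` EVERYWHERE on the analytic slice.**  Let
`f : ℝ³ → ℝ³` be real-analytic, `b : Fin 3`, and suppose that on a nonempty open set `U` the vertical shear of `f_b` is SOME function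
of the height component times its horizontal gradient entry, `∂_z f_b = g(f₂)·∂_b f₂` (`∂_z = D(·)(e₂)`, `∂_b = D(·)(e_b)`; no
regularity on `g`).  Then for every `x ∈ ℝ³` and all directions `u, u'`:
`[(∂_b f₂·D(∂_z f_b) − ∂_z f_b·D(∂_b f₂))(x) u]·[Df₂(x) u'] − [(…)(x) u']·[Df₂(x) u] = 0`,
i.e. the vector `D_b(x)` is parallel to `∇f₂(x)`. [folklore] -/
theorem minors_eq_zero_of_local_slope_function {f : EuclideanSpace ℝ (Fin 3) → EuclideanSpace ℝ (Fin 3)}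
    (hf : AnalyticOnNhd ℝ f univ) {b : Fin 3} {g : ℝ → ℝ} {U : Set (EuclideanSpace ℝ (Fin 3))}
    (hU : IsOpen U) (hUne : U.Nonempty)
    (hloc : ∀ x ∈ U, fderiv ℝ f x (EuclideanSpace.single 2 1) b =
      g (f x 2) * fderiv ℝ f x (EuclideanSpace.single b 1) 2)
    (x u u' : EuclideanSpace ℝ (Fin 3)) :
    (fderiv ℝ f x (EuclideanSpace.single b 1) 2 *
          fderiv ℝ (fun y => fderiv ℝ f y (EuclideanSpace.single 2 1) b) x u -
        fderiv ℝ f x (EuclideanSpace.single 2 1) b *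
          fderiv ℝ (fun y => fderiv ℝ f y (EuclideanSpace.single b 1) 2) x u) *
        fderiv ℝ (fun y => f y 2) x u' -
      (fderiv ℝ f x (EuclideanSpace.single b 1) 2 *
          fderiv ℝ (fun y => fderiv ℝ f y (EuclideanSpace.single 2 1) b) x u' -
        fderiv ℝ f x (EuclideanSpace.single 2 1) b *
          fderiv ℝ (fun y => fderiv ℝ f y (EuclideanSpace.single b 1) 2) x u') *
        fderiv ℝ (fun y => f y 2) x u = 0 := by
  -- the three scalar functions and their analyticity
  set N : EuclideanSpace ℝ (Fin 3) → ℝ := fun y => fderiv ℝ f y (EuclideanSpace.single 2 1) b with hNdef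
  set D : EuclideanSpace ℝ (Fin 3) → ℝ := fun y => fderiv ℝ f y (EuclideanSpace.single b 1) 2 with hDdef
  set w : EuclideanSpace ℝ (Fin 3) → ℝ := fun y => f y 2 with hwdef
  have hN : AnalyticOnNhd ℝ N univ := analyticOnNhd_fderiv_apply_coord hf _ _
  have hD : AnalyticOnNhd ℝ D univ := analyticOnNhd_fderiv_apply_coord hf _ _
  have hw : AnalyticOnNhd ℝ w univ := analyticOnNhd_coord hf 2
  -- the minor as an analytic function of the point
  set M : EuclideanSpace ℝ (Fin 3) → ℝ := fun y =>
    (D y * fderiv ℝ N y u - N y * fderiv ℝ D y u) * fderiv ℝ w y u' -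
      (D y * fderiv ℝ N y u' - N y * fderiv ℝ D y u') * fderiv ℝ w y u with hMdef
  have hM : AnalyticOnNhd ℝ M univ :=
    ((((hD.mul (analyticOnNhd_fderiv_apply hN u)).sub (hN.mul (analyticOnNhd_fderiv_apply hD u))).mul
      (analyticOnNhd_fderiv_apply hw u')).sub
      (((hD.mul (analyticOnNhd_fderiv_apply hN u')).sub (hN.mul (analyticOnNhd_fderiv_apply hD u'))).mul
      (analyticOnNhd_fderiv_apply hw u)))
  change M x = 0
  -- the pointwise lemma at points of `U` where `D ≠ 0`
  have hpt : ∀ y ∈ U, D y ≠ 0 → M y = 0 := by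
    intro y hyU hyD
    have hfy : DifferentiableAt ℝ f y := (hf y (mem_univ _)).differentiableAt
    have hwy : HasStrictFDerivAt w (fderiv ℝ w y) y :=
      ((hw y (mem_univ _)).contDiffAt (n := 1)).hasStrictFDerivAt one_ne_zero
    have hwe : fderiv ℝ w y (EuclideanSpace.single b 1) = D y := by
      simp only [hwdef, hDdef, fderiv_coord_apply hfy]
    have he : (fderiv ℝ w y) (EuclideanSpace.single b 1) ≠ 0 := by rw [hwe]; exact hyD
    have hlocy : ∀ᶠ y' in 𝓝 y, N y' = g (w y') * D y' := by
      filter_upwards [hU.mem_nhds hyU] with y' hy'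
      exact hloc y' hy'
    obtain ⟨c, hc⟩ := exists_sub_smul_eq_smul_of_eventuallyEq_mul hwy he
      (hN y (mem_univ _)).differentiableAt (hD y (mem_univ _)).differentiableAt hyD hlocy
    have h1 := minor_eq_zero_of_eq_smul hc u u'
    simp only [sub_apply, smul_apply, smul_eq_mul] at h1
    simpa [hMdef] using h1
  by_cases hcase : ∃ x₀ ∈ U, D x₀ ≠ 0
  · -- `M` vanishes near `x₀`, hence everywhere
    obtain ⟨x₀, hx₀U, hx₀⟩ := hcase
    have hMz : M =ᶠ[𝓝 x₀] 0 := by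
      have h1 : ∀ᶠ y in 𝓝 x₀, y ∈ U := hU.mem_nhds hx₀U
      have h2 : ∀ᶠ y in 𝓝 x₀, D y ≠ 0 := (hD x₀ (mem_univ _)).continuousAt.eventually_ne hx₀
      filter_upwards [h1, h2] with y hyU hyD
      exact hpt y hyU hyD
    exact hM.eqOn_zero_of_preconnected_of_eventuallyEq_zero isPreconnected_univ (mem_univ x₀) hMz (mem_univ x)
  · -- `D ≡ 0` on `U`, hence on `ℝ³`; then `D_b(x) = 0`
    push Not at hcase
    obtain ⟨x₀, hx₀U⟩ := hUne
    have hDz : D =ᶠ[𝓝 x₀] 0 := by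
      filter_upwards [hU.mem_nhds hx₀U] with y hy
      exact hcase y hy
    have hD0 : EqOn D 0 univ :=
      hD.eqOn_zero_of_preconnected_of_eventuallyEq_zero isPreconnected_univ (mem_univ x₀) hDz
    have hDfun : D = fun _ => (0 : ℝ) := funext fun y => hD0 (mem_univ y)
    have hDx : D x = 0 := hD0 (mem_univ x)
    have hfD : ∀ v : EuclideanSpace ℝ (Fin 3), fderiv ℝ D x v = 0 := fun v => by
      rw [hDfun]; simp
    simp only [hMdef, hDx, hfD, zero_mul, mul_zero, sub_self]

/-! ## L0(a), class entry -/

/-- **L0(a) for the route's class (Type-I ancient mild profiles).**  Let `v` have the Type-I time rate, be continuous on the open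
backward slab and satisfy the unit-viscosity Oseen identity between negative times (the class binders of `stub_zShockThickAut`;
divergence-freeness and poloidality are not needed here).  If at a space–time point `z₀` of an open set `W₁` the stub's LOCAL
autonomy clause holds — `∂_z v_b = g(t, v₂)·∂_b v₂` on `W₁` for `b ≠ 2`, SOME `g : ℝ → ℝ → ℝ` — then on the WHOLE slice
`t₀ = z₀.1` and for every `b ≠ 2` the analytic vector `D_b = ∂_b v₂·∇(∂_z v_b) − ∂_z v_b·∇(∂_b v₂)` is everywhere parallel to `∇v₂`
(all `2 × 2` minors vanish).  Slice analyticity: tree `…Ancient.analyticOnNhd_slice` (Oseen-ancient bounded mild fields are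
real-analytic).  [folklore] -/
theorem minors_eq_zero_of_class_autonomy (C : ℝ) (v : ℝ → EuclideanSpace ℝ (Fin 3) → EuclideanSpace ℝ (Fin 3))
    (hrate : Literature.Analysis.FluidPDE.HasTypeITimeDecay C v)
    (hcont : ContinuousOn (Function.uncurry v) (Set.Iio (0 : ℝ) ×ˢ Set.univ))
    (hmild : ∀ s t : ℝ, s < t → t < 0 → ∀ x, v t x =
      Literature.Analysis.UnboundedOperators.heatExtension (v s) (t - s) x -
        Literature.Analysis.FluidPDE.oseenDuhamel 1 s v v t x)
    {W₁ : Set (ℝ × EuclideanSpace ℝ (Fin 3))} (hW₁ : IsOpen W₁) (hW₁s : W₁ ⊆ Set.Iio (0 : ℝ) ×ˢ Set.univ)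
    {z₀ : ℝ × EuclideanSpace ℝ (Fin 3)} (hz₀ : z₀ ∈ W₁) {g : ℝ → ℝ → ℝ}
    (haut : ∀ z ∈ W₁, ∀ b : Fin 3, b ≠ 2 →
      fderiv ℝ (v z.1) z.2 (EuclideanSpace.single 2 1) b =
        g z.1 (v z.1 z.2 2) * fderiv ℝ (v z.1) z.2 (EuclideanSpace.single b 1) 2)
    {b : Fin 3} (hb : b ≠ 2) (x u u' : EuclideanSpace ℝ (Fin 3)) :
    (fderiv ℝ (v z₀.1) x (EuclideanSpace.single b 1) 2 *
          fderiv ℝ (fun y => fderiv ℝ (v z₀.1) y (EuclideanSpace.single 2 1) b) x u -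
        fderiv ℝ (v z₀.1) x (EuclideanSpace.single 2 1) b *
          fderiv ℝ (fun y => fderiv ℝ (v z₀.1) y (EuclideanSpace.single b 1) 2) x u) *
        fderiv ℝ (fun y => v z₀.1 y 2) x u' -
      (fderiv ℝ (v z₀.1) x (EuclideanSpace.single b 1) 2 *
          fderiv ℝ (fun y => fderiv ℝ (v z₀.1) y (EuclideanSpace.single 2 1) b) x u' -
        fderiv ℝ (v z₀.1) x (EuclideanSpace.single 2 1) b *
          fderiv ℝ (fun y => fderiv ℝ (v z₀.1) y (EuclideanSpace.single b 1) 2) x u') *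
        fderiv ℝ (fun y => v z₀.1 y 2) x u = 0 := by
  -- the slice time and its analyticity
  have ht₀ : z₀.1 < 0 := (Set.mem_prod.1 (hW₁s hz₀)).1
  have hbdd : ∀ δ : ℝ, 0 < δ → ∃ B : ℝ, ∀ t < -δ, ∀ y : EuclideanSpace ℝ (Fin 3), ‖v t y‖ ≤ B := by
    intro δ hδ
    refine ⟨|C| / Real.sqrt δ, fun t ht y => ?_⟩
    have hδt : δ ≤ -t := by linarith
    have hsq : Real.sqrt δ ≤ Real.sqrt (-t) := Real.sqrt_le_sqrt hδt
    have hsqpos : 0 < Real.sqrt δ := Real.sqrt_pos.2 hδ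
    calc ‖v t y‖ ≤ C / Real.sqrt (-t) := hrate t (by linarith) y
      _ ≤ |C| / Real.sqrt (-t) := by gcongr; exact le_abs_self C
      _ ≤ |C| / Real.sqrt δ := by gcongr
  have han : AnalyticOnNhd ℝ (v z₀.1) univ :=
    Literature.Analysis.NavierStokesZoomKit.LocalSineTubeDoorProfileAlignedWindowRigidityAncient.analyticOnNhd_slice
      hcont hbdd hmild ht₀
  -- the slice of `W₁` at time `z₀.1` is an open set containing `z₀.2`
  set U : Set (EuclideanSpace ℝ (Fin 3)) := {y | (z₀.1, y) ∈ W₁} with hUdef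
  have hU : IsOpen U := hW₁.preimage (Continuous.prodMk_right z₀.1)
  have hUne : U.Nonempty := ⟨z₀.2, by simp [hUdef, hz₀]⟩
  have hloc : ∀ y ∈ U, fderiv ℝ (v z₀.1) y (EuclideanSpace.single 2 1) b =
      g z₀.1 (v z₀.1 y 2) * fderiv ℝ (v z₀.1) y (EuclideanSpace.single b 1) 2 :=
    fun y hy => haut (z₀.1, y) hy b hb
  exact minors_eq_zero_of_local_slope_function han hU hUne hloc x u u'

end Summit.NavierStokesRegularity.NavierStokesRegularity.Theorems.PoloidalWindowDoorPoloidalWindowRigidityZShockAutonomyGlobal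

end
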